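import Summits.Langlands.Langlands.Statement
import HarnessLib

/-!
# SKELETON — line `split-x2-weak-existence` for the crux `ReciprocityUpToIrreducibility` (item stmt-Langlands-14328;
routes OrdinaryPrimeTransport / IrreducibilityBySelfDuality), crux-strategist planner-cstrat-stmt-Langlands-14328-r1-0

Plan for piece X₂ `WeakExistence` (crux; child of the split `directional-split`): W (automorphic → Galois,
weak form) splits along the catalogued barrier `Literature.Barriers.Langlands.NonRegularWeightBarrier` and, on the
regular sector, by the one-prime/companions mechanism (crux idea `one-prime-companions`, Taylor 2004 Conj. 3(a)):

* `stub_weakExistence_regular_onePrime` — for π L-algebraic cuspidal WITH a regular infinity type: a pinned-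
  geometric a.e.-compatible avatar at ONE prime ℓ₀ and one ι₀ (the Shimura-variety / eigenvariety constructions:
  Clozel–Kottwitz–HT for polarizable π, HLTT 2016 / Scholze 2015 for regular π over CM fields — there every prime
  at once —; open for general number fields; de Rham-ness of the HLTT/Scholze representations: A'Campo 2024,
  arXiv:2607.11763 Thm 1.2.1 over CM);
* `stub_companions_regular` — for regular π: ONE pinned-geometric compatible avatar at (ℓ₀, ι₀) gives one at
  every (ℓ, ι) (existence of the compatible system / companions: Taylor 2004 Conj. 3(a); known for regular
  polarizable systems by potential automorphy, BLGGT 2014 Thm 5.5.1; L. Lafforgue / Drinfeld over function fields);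
* `stub_weakExistence_irregular` — for π WITHOUT a regular infinity type: avatars at every prime (congruences to
  regular forms prime by prime: Deligne–Serre for weight one, Taylor 1991 / Goldring–Koskivirta for irregular
  Hilbert–Siegel, Scholze–Boxer–Pilloni torsion methods; wide open in general — the NonRegularWeightBarrier).

Composition `WeakExistence_of`: case split on regularity; regular ⇒ one prime ⇒ companions.  No stub is W: each
is W restricted to a sector and/or to one prime.  Stubs are the ONLY sorries.
-/

noncomputable section
set_option linter.dupNamespace false

namespace Summit.Langlands.Langlands.Cruxes.ReciprocityUpToIrreducibility.SplitX2

open scoped NumberField Classical Polynomial BigOperators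
open Filter IsDedekindDomain Polynomial
open Literature.NumberTheory.Automorphic Literature.NumberTheory.GaloisRepresentations
open Summit.Langlands

/-- Piece X₂, verbatim as filed. -/
def WeakExistence : Prop :=
  ∀ (K : Type) [Field K] [NumberField K] (n : ℕ) (hcpt : Literature.NumberTheory.Automorphic.isCompact_glFiniteIntegralLevel n K), 0 < n → ∀ π : Literature.NumberTheory.Automorphic.CuspidalAutomorphicRepData n K hcpt, π.1.IsLAlgebraic → ∀ (ℓ : ℕ) [Fact ℓ.Prime] (ι : PadicAlgCl ℓ ≃+* ℂ), ∃ ρ : Literature.NumberTheory.GaloisRepresentations.FramedGaloisRep K (PadicAlgCl ℓ) n, ((∀ᶠ v : IsDedekindDomain.HeightOneSpectrum (NumberField.RingOfIntegers K) in Filter.cofinite, ρ.IsUnramifiedAt v) ∧ ∀ (v : IsDedekindDomain.HeightOneSpectrum (NumberField.RingOfIntegers K)) (hv : ((ℓ : ℕ) : NumberField.RingOfIntegers K) ∈ v.asIdeal), (Literature.NumberTheory.PAdicHodge.fontainePstAdicCompletion v ℓ hv).IsDeRhamFramed (ρ.toLocal v)) ∧ ∀ᶠ v : IsDedekindDomain.HeightOneSpectrum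 (NumberField.RingOfIntegers K) in Filter.cofinite, Summit.Langlands.SatakeFrobCompatibleAt ι π.1 ρ v

/-- **W on the REGULAR sector at ONE prime (OPEN off TR/CM fields; HLTT/Scholze + A'Campo over CM).** [cite: HarrisLanTaylorThorneRMS2016, Thm. A] [cite: Scholze2015, Thm. V.4.2] [cite: arXiv:2607.11763, Thm. 1.2.1] -/
theorem stub_weakExistence_regular_onePrime :
    ∀ (K : Type) [Field K] [NumberField K] (n : ℕ) (hcpt : Literature.NumberTheory.Automorphic.isCompact_glFiniteIntegralLevel n K), 0 < n → ∀ π : Literature.NumberTheory.Automorphic.CuspidalAutomorphicRepData n K hcpt, π.1.IsLAlgebraic → (∃ T : Literature.NumberTheory.Automorphic.InfinityType K n, π.1.HasInfinityType T ∧ T.IsRegular) → ∃ (ℓ₀ : ℕ) (_ : Fact ℓ₀.Prime) (ι₀ : PadicAlgCl ℓ₀ ≃+* ℂ) (ρ₀ : Literature.NumberTheory.GaloisRepresentations.FramedGaloisRep K (PadicAlgCl ℓ₀) n), ((∀ᶠ v : IsDedekindDomain.HeightOneSpectrum (NumberField.RingOfIntegers K) in Filter.cofinite, ρ₀.IsUnramifiedAt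 v) ∧ ∀ (v : IsDedekindDomain.HeightOneSpectrum (NumberField.RingOfIntegers K)) (hv : ((ℓ₀ : ℕ) : NumberField.RingOfIntegers K) ∈ v.asIdeal), (Literature.NumberTheory.PAdicHodge.fontainePstAdicCompletion v ℓ₀ hv).IsDeRhamFramed (ρ₀.toLocal v)) ∧ ∀ᶠ v : IsDedekindDomain.HeightOneSpectrum (NumberField.RingOfIntegers K) in Filter.cofinite, Summit.Langlands.SatakeFrobCompatibleAt ι₀ π.1 ρ₀ v := by
  sorry

/-- **Companions on the regular sector (OPEN; Taylor 2004 Conj. 3(a); BLGGT 2014 Thm 5.5.1 in the polarizable case):** one pinned-geometric compatible avatar at (ℓ₀, ι₀) ⇒ one at every (ℓ, ι). [cite: TaylorGaloisRepresentations2004, Conj. 3] [cite: doi:10.4007/annals.2014.179.2.3, Thm. 5.5.1] -/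
theorem stub_companions_regular :
    ∀ (K : Type) [Field K] [NumberField K] (n : ℕ) (hcpt : Literature.NumberTheory.Automorphic.isCompact_glFiniteIntegralLevel n K), 0 < n → ∀ π : Literature.NumberTheory.Automorphic.CuspidalAutomorphicRepData n K hcpt, π.1.IsLAlgebraic → (∃ T : Literature.NumberTheory.Automorphic.InfinityType K n, π.1.HasInfinityType T ∧ T.IsRegular) → ∀ (ℓ₀ : ℕ) [Fact ℓ₀.Prime] (ι₀ : PadicAlgCl ℓ₀ ≃+* ℂ) (ρ₀ : Literature.NumberTheory.GaloisRepresentations.FramedGaloisRep K (PadicAlgCl ℓ₀) n), ((∀ᶠ v : IsDedekindDomain.HeightOneSpectrum (NumberField.RingOfIntegers K) in Filter.cofinite, ρ₀.IsUnramifiedAt v) ∧ ∀ (v : IsDedekindDomain.HeightOneSpectrum (NumberField.RingOfIntegers K)) (hv : ((ℓ₀ : ℕ) : NumberField.RingOfIntegers K) ∈ v.asIdeal), (Literature.NumberTheory.PAdicHodge.fontainePstAdicCompletion v ℓ₀ hv).IsDeRhamFramed (ρ₀.toLocal v)) → (∀ᶠ v : IsDedekindDomain.HeightOneSpectrum (NumberField.RingOfIntegers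 K) in Filter.cofinite, Summit.Langlands.SatakeFrobCompatibleAt ι₀ π.1 ρ₀ v) → ∀ (ℓ : ℕ) [Fact ℓ.Prime] (ι : PadicAlgCl ℓ ≃+* ℂ), ∃ ρ : Literature.NumberTheory.GaloisRepresentations.FramedGaloisRep K (PadicAlgCl ℓ) n, ((∀ᶠ v : IsDedekindDomain.HeightOneSpectrum (NumberField.RingOfIntegers K) in Filter.cofinite, ρ.IsUnramifiedAt v) ∧ ∀ (v : IsDedekindDomain.HeightOneSpectrum (NumberField.RingOfIntegers K)) (hv : ((ℓ : ℕ) : NumberField.RingOfIntegers K) ∈ v.asIdeal), (Literature.NumberTheory.PAdicHodge.fontainePstAdicCompletion v ℓ hv).IsDeRhamFramed (ρ.toLocal v)) ∧ ∀ᶠ v : IsDedekindDomain.HeightOneSpectrum (NumberField.RingOfIntegers K) in Filter.cofinite, Summit.Langlands.SatakeFrobCompatibleAt ι π.1 ρ v := by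
  sorry

/-- **W on the IRREGULAR sector (OPEN: the NonRegularWeightBarrier; Deligne–Serre, Taylor 1991, Goldring–Koskivirta, Boxer–Calegari–Gee–Pilloni in low rank).** [cite: DeligneSerreASENS1974, Thm. 4.1] [cite: BuzzardGeeLMS2014, Conj. 3.2.2] -/
theorem stub_weakExistence_irregular :
    ∀ (K : Type) [Field K] [NumberField K] (n : ℕ) (hcpt : Literature.NumberTheory.Automorphic.isCompact_glFiniteIntegralLevel n K), 0 < n → ∀ π : Literature.NumberTheory.Automorphic.CuspidalAutomorphicRepData n K hcpt, π.1.IsLAlgebraic → ¬ (∃ T : Literature.NumberTheory.Automorphic.InfinityType K n, π.1.HasInfinityType T ∧ T.IsRegular) → ∀ (ℓ : ℕ) [Fact ℓ.Prime] (ι : PadicAlgCl ℓ ≃+* ℂ), ∃ ρ : Literature.NumberTheory.GaloisRepresentations.FramedGaloisRep K (PadicAlgCl ℓ) n, ((∀ᶠ v : IsDedekindDomain.HeightOneSpectrum (NumberField.RingOfIntegers K) in Filter.cofinite, ρ.IsUnramifiedAt v) ∧ ∀ (v : IsDedekindDomain.HeightOneSpectrum (NumberField.RingOfIntegers K)) (hv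 : ((ℓ : ℕ) : NumberField.RingOfIntegers K) ∈ v.asIdeal), (Literature.NumberTheory.PAdicHodge.fontainePstAdicCompletion v ℓ hv).IsDeRhamFramed (ρ.toLocal v)) ∧ ∀ᶠ v : IsDedekindDomain.HeightOneSpectrum (NumberField.RingOfIntegers K) in Filter.cofinite, Summit.Langlands.SatakeFrobCompatibleAt ι π.1 ρ v := by
  sorry

/-- **COMPOSITION — piece X₂ from the three stubs** (case split on regularity; regular: one prime, then
companions). -/
theorem WeakExistence_of : WeakExistence := by
  intro K _ _ n hcpt hn π hL ℓ _ ι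
  by_cases hreg : (∃ T : Literature.NumberTheory.Automorphic.InfinityType K n, π.1.HasInfinityType T ∧ T.IsRegular)
  · obtain ⟨ℓ₀, hF₀, ι₀, ρ₀, hgeo₀, hρ₀⟩ := stub_weakExistence_regular_onePrime K n hcpt hn π hL hreg
    haveI : Fact ℓ₀.Prime := hF₀
    exact stub_companions_regular K n hcpt hn π hL hreg ℓ₀ ι₀ ρ₀ hgeo₀ hρ₀ ℓ ι
  · exact stub_weakExistence_irregular K n hcpt hn π hL hreg ℓ ι

end Summit.Langlands.Langlands.Cruxes.ReciprocityUpToIrreducibility.SplitX2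

end
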